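import Summits.HubbardSuperconductivity.HubbardLadder.Bounds.ThermalTrialOperatorStiffnessCeiling
import Summits.HubbardSuperconductivity.HubbardLadder.Bounds.ThermalKuboCurvatureNumberConserving
import HarnessLib

/-!
# Hubbard ladder — Bounds: the thermal trial-operator (Bogoliubov) stiffness ceiling,
# part 2 of 2 — the general number-conserving class, any finite hopping graph, any sector

HONEST FRAMING (cell pub-hubbard): ladder R1–R4 with certified numbers; no claim on H/H₀. This
file states BOUNDS FOR A MODEL CLASS (no materials claim) and proves them; nothing here is a cited
fact. Companion text: `pub-hubbard/paper/bounds.tex` Thm 6_T♯; table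
`pub-hubbard/pub-hubbard-bounds/BOUNDS.md` row T1k. Part 1
(`ThermalTrialOperatorStiffnessCeiling.lean`) holds the engine
`le_sub_trialOperator_of_le_sub_duhamel` and the `t–t'` torus node.

Setting of `ThermalKuboCurvatureNumberConserving.lean` (Paramekanti–Trivedi–Randeria class):
`Λ` finite, `t` symmetric real, `d` antisymmetric real (bond phase gradients), `V` ANY Hermitian
Fock-space matrix ("all number-conserving interactions and fields"), `β > 0`, `p` any set of
occupation configurations, `H_p = (T(t) + V)|_p`, `J_p = T(i t d)|_p`,
`G₁^β(d) = Σ_{x,y,σ} d_{xy}² (−t_{xy} Re⟨c†_{xσ} c_{yσ}⟩_β)/2`, and for a Hermitian trial operator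
`C` on the sector space `m(C) = ‖⟨C J_p − J_p C⟩_β‖`, `c(C) = Re⟨C[H_p,C] − [H_p,C]C⟩_β`.

* `ThermalTrialOperatorStiffnessCeilingNumberConserving` (THEOREM): under the flux-floor
  hypothesis `β ρ θ² ≤ log Z_p(H(0)) − log Z_p(H(θd))` (`|θ| ≤ θ₀`), for EVERY Hermitian `C`:
  (i) `ρ ≤ G₁^β(d) − μ m(C) + (μ²/2) c(C)` for every `μ : ℝ`;
  (ii) `ρ ≤ G₁^β(d) − m(C)²/(2c(C))`; (iii) `0 ≤ c(C)`; (iv) `Re⟨J_p⟩_β = 0`.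
  A β-free ceiling on every admissible thermal stiffness coefficient by three EQUAL-TIME Gibbs
  moments of the unperturbed sector state, for the whole class; from the Kubo-curvature ceiling
  `thermalKuboCurvatureCeiling_numberConserving` and the sharp (Duhamel) Bogoliubov inequality.
* `ThermalTrialOperatorStiffnessCeilingNumberConservingGauge` (THEOREM): with `V` invariant under
  every site-phase gauge, the same four conclusions for `d + dχ`, every `χ : Λ → ℝ`.
* Operator-norm ("state-free curvature") forms: `le_sub_trialOperator_opNorm_of_le_sub_duhamel`
  (model-free engine: `c(C)` may be replaced by the OPERATOR NORM `‖C[H,C] − [H,C]C‖`, so the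
  ceiling needs only TWO state-dependent numbers, `G` and `m(C) = ‖⟨[C,J]⟩‖`),
  `thermalStiffnessTT'_le_kin_sub_trialOperator_opNorm` + node
  `ThermalTrialOperatorOpNormStiffnessCeilingTT'` (the `t–t'` torus) and
  `thermalStiffness_le_fsum_sub_trialOperator_opNorm_numberConserving` + node
  `ThermalTrialOperatorOpNormStiffnessCeilingNumberConserving` (the class), all PROVED.

References: DLS1978 §2 eqs. (22'), (27), (28) (sharp Bogoliubov); ScalapinoWhiteZhang1993 §II;
ParamekantiTrivediRanderia1998 §IV; HazraVermaRanderia2019 eq. (2).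
-/

noncomputable section

namespace Summit.HubbardSuperconductivity.HubbardLadder.Bounds

open Matrix Finset Literature.MathematicalPhysics.QuantumLattice
  Literature.MathematicalPhysics.QuantumFieldTheory

open scoped ComplexConjugate ComplexOrder Matrix.Norms.L2Operator

/-- **Node (THEOREM, proved below): thermal trial-operator (Bogoliubov) stiffness ceiling, full
number-conserving class, any finite hopping graph, any coordinate sector, `T > 0`.** With
`H_p = (T(t)+V)|_p`, `J_p = T(i t d)|_p`, `C` any Hermitian operator on the sector space,
`m(C) = ‖⟨CJ_p − J_pC⟩‖`, `c(C) = Re⟨C[H_p,C] − [H_p,C]C⟩`: the flux-floor hypothesis of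
`ThermalKuboCurvatureCeilingNumberConserving` implies (i) `ρ ≤ G₁^β(d) − μ m(C) + (μ²/2) c(C)`
for every `μ : ℝ`, (ii) `ρ ≤ G₁^β(d) − m(C)²/(2c(C))`, (iii) `0 ≤ c(C)`, (iv) `Re⟨J_p⟩ = 0`.
[cite: DLS1978, §2 eqs. (22'), (27), (28)] [cite: ScalapinoWhiteZhang1993, §II] -/
@[conjecture] def ThermalTrialOperatorStiffnessCeilingNumberConserving : Prop :=
  ∀ (Λ : Type) [LinearOrder Λ] [Fintype Λ] (t d : Λ → Λ → ℝ), (∀ x y, t y x = t x y) →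
    (∀ x y, d y x = -d x y) → ∀ (V : Matrix (Finset (Orb Λ)) (Finset (Orb Λ)) ℂ), V.IsHermitian →
    ∀ (β : ℝ), 0 < β → ∀ (p : Finset (Orb Λ) → Prop) [Fintype {a // p a}] [DecidableEq {a // p a}]
      (ρ θ₀ : ℝ), 0 < θ₀ →
      (∀ θ : ℝ, |θ| ≤ θ₀ →
        β * (ρ * θ ^ 2) ≤
          Real.log (partitionFn β ((bdgHopping (fun x y => (t x y : ℂ)) + V).toBlock p p)).re -
            Real.log (partitionFn β
              ((bdgHopping (fun x y => (t x y : ℂ) *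
                  Complex.exp (((θ * d x y : ℝ) : ℂ) * Complex.I)) + V).toBlock p p)).re) →
      ∀ (C : Matrix {a // p a} {a // p a} ℂ), C.IsHermitian →
      let Hp := (bdgHopping (fun x y => (t x y : ℂ)) + V).toBlock p p
      let Jp := (bdgHopping fun x y => ((t x y * d x y : ℝ) : ℂ) * Complex.I).toBlock p p
      let G := ∑ x : Λ, ∑ y : Λ, ∑ σ : Fin 2, d x y ^ 2 *
            (-(t x y * (gibbsState β Hp
              ((creation (orb x σ) * annihilation (orb y σ)).toBlock p p)).re) / 2)
      (∀ μ : ℝ, ρ ≤ G - μ * ‖gibbsState β Hp (C * Jp - Jp * C)‖ +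
          μ ^ 2 / 2 * (gibbsState β Hp (C * (Hp * C - C * Hp) - (Hp * C - C * Hp) * C)).re) ∧
        ρ ≤ G - ‖gibbsState β Hp (C * Jp - Jp * C)‖ ^ 2 /
          (2 * (gibbsState β Hp (C * (Hp * C - C * Hp) - (Hp * C - C * Hp) * C)).re) ∧
        0 ≤ (gibbsState β Hp (C * (Hp * C - C * Hp) - (Hp * C - C * Hp) * C)).re ∧
        (gibbsState β Hp Jp).re = 0

/-- **Node (THEOREM, proved below): gauge form.** With `V` invariant under every site-phase gauge,
the four conclusions of `ThermalTrialOperatorStiffnessCeilingNumberConserving` hold with `d`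
replaced by `d + dχ` for every `χ : Λ → ℝ` (and every Hermitian `C`).
[cite: DLS1978, §2 eqs. (22'), (27), (28)] [cite: ParamekantiTrivediRanderia1998, §IV] -/
@[conjecture] def ThermalTrialOperatorStiffnessCeilingNumberConservingGauge : Prop :=
  ∀ (Λ : Type) [LinearOrder Λ] [Fintype Λ] (t d : Λ → Λ → ℝ), (∀ x y, t y x = t x y) →
    (∀ x y, d y x = -d x y) → ∀ (V : Matrix (Finset (Orb Λ)) (Finset (Orb Λ)) ℂ), V.IsHermitian →
    (∀ φ : Λ → ℝ, (phaseGauge fun x => Circle.exp (φ x))ᴴ * V *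
      phaseGauge (fun x => Circle.exp (φ x)) = V) →
    ∀ (β : ℝ), 0 < β → ∀ (p : Finset (Orb Λ) → Prop) [Fintype {a // p a}] [DecidableEq {a // p a}]
      (ρ θ₀ : ℝ), 0 < θ₀ →
      (∀ θ : ℝ, |θ| ≤ θ₀ →
        β * (ρ * θ ^ 2) ≤
          Real.log (partitionFn β ((bdgHopping (fun x y => (t x y : ℂ)) + V).toBlock p p)).re -
            Real.log (partitionFn β
              ((bdgHopping (fun x y => (t x y : ℂ) *
                  Complex.exp (((θ * d x y : ℝ) : ℂ) * Complex.I)) + V).toBlock p p)).re) →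
      ∀ χ : Λ → ℝ, ∀ (C : Matrix {a // p a} {a // p a} ℂ), C.IsHermitian →
      let Hp := (bdgHopping (fun x y => (t x y : ℂ)) + V).toBlock p p
      let Jp := (bdgHopping fun x y =>
        ((t x y * (d x y + (χ y - χ x)) : ℝ) : ℂ) * Complex.I).toBlock p p
      let G := ∑ x : Λ, ∑ y : Λ, ∑ σ : Fin 2, (d x y + (χ y - χ x)) ^ 2 *
            (-(t x y * (gibbsState β Hp
              ((creation (orb x σ) * annihilation (orb y σ)).toBlock p p)).re) / 2)
      (∀ μ : ℝ, ρ ≤ G - μ * ‖gibbsState β Hp (C * Jp - Jp * C)‖ +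
          μ ^ 2 / 2 * (gibbsState β Hp (C * (Hp * C - C * Hp) - (Hp * C - C * Hp) * C)).re) ∧
        ρ ≤ G - ‖gibbsState β Hp (C * Jp - Jp * C)‖ ^ 2 /
          (2 * (gibbsState β Hp (C * (Hp * C - C * Hp) - (Hp * C - C * Hp) * C)).re) ∧
        0 ≤ (gibbsState β Hp (C * (Hp * C - C * Hp) - (Hp * C - C * Hp) * C)).re ∧
        (gibbsState β Hp Jp).re = 0

/-! ### Proofs -/

section Proofs

variable {Λ : Type} [LinearOrder Λ] [Fintype Λ]

/-- `ThermalTrialOperatorStiffnessCeilingNumberConserving` holds. -/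
theorem thermalTrialOperatorStiffnessCeilingNumberConserving_holds :
    ThermalTrialOperatorStiffnessCeilingNumberConserving := by
  intro Λ _ _ t d ht hd V hV β hβ p _ _ ρ θ₀ hθ₀ hstiff C hC Hp Jp G
  have hHp : Hp.IsHermitian := ((isHermitian_bdgHopping_real ht).add hV).submatrix _
  have hJp : Jp.IsHermitian := (isHermitian_current ht hd).submatrix _
  obtain ⟨h1, h2⟩ := thermalKuboCurvatureCeiling_numberConserving ht hd hV hβ p hθ₀ hstiff
  obtain ⟨h3, h4, h5⟩ := le_sub_trialOperator_of_le_sub_duhamel hHp hJp hC hβ.le h1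
  exact ⟨h3, h4, h5, h2⟩

/-- `ThermalTrialOperatorStiffnessCeilingNumberConservingGauge` holds. -/
theorem thermalTrialOperatorStiffnessCeilingNumberConservingGauge_holds :
    ThermalTrialOperatorStiffnessCeilingNumberConservingGauge := by
  intro Λ _ _ t d ht hd V hV hVg β hβ p _ _ ρ θ₀ hθ₀ hstiff χ C hC Hp Jp G
  have hd' : ∀ x y, d y x + (χ x - χ y) = -(d x y + (χ y - χ x)) := fun x y => by
    rw [hd x y]; ring
  have hHp : Hp.IsHermitian := ((isHermitian_bdgHopping_real ht).add hV).submatrix _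
  have hJp : Jp.IsHermitian :=
    (isHermitian_current (d := fun x y => d x y + (χ y - χ x)) ht hd').submatrix _
  obtain ⟨h1, h2⟩ :=
    thermalKuboCurvatureCeilingNumberConservingGauge_holds Λ t d ht hd V hV hVg β hβ p ρ θ₀ hθ₀
      hstiff χ
  obtain ⟨h3, h4, h5⟩ := le_sub_trialOperator_of_le_sub_duhamel hHp hJp hC hβ.le h1
  exact ⟨h3, h4, h5, h2⟩

end Proofs

/-! ### Operator-norm ("state-free curvature") forms

`c(C) = Re⟨C[H,C] − [H,C]C⟩_β ≤ ‖C[H,C] − [H,C]C‖` (states are bounded by the operator norm,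
`abs_re_gibbsState_le`), and the optimal trial-operator ceiling `G − m²/(2c)` is antitone in `c`
(given Bogoliubov's `m² ≤ β b c`). Hence every conclusion survives with `c(C)` replaced by the
STATE-FREE number `‖C[H,C] − [H,C]C‖` (the `L²`-operator norm of `Matrix.Norms.L2Operator`): the
ceiling then depends on the Gibbs state only through `G` and the single commutator expectation
`⟨CJ − JC⟩_β`. -/

section OpNorm

variable {m : Type*} [Fintype m] [DecidableEq m]

/-- **Engine, operator-norm form.** For Hermitian `H, J, C`, `β ≥ 0` and reals `ρ, G` with
`ρ ≤ G − (β/2) Re (J,J)_Duh`: (i) `ρ ≤ G − μ‖⟨CJ − JC⟩‖ + (μ²/2)‖C(HC−CH) − (HC−CH)C‖` for every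
`μ : ℝ`; (ii) `ρ ≤ G − ‖⟨CJ − JC⟩‖²/(2‖C(HC−CH) − (HC−CH)C‖)`;
(iii) `Re⟨C(HC−CH) − (HC−CH)C⟩ ≤ ‖C(HC−CH) − (HC−CH)C‖`.
[cite: DLS1978, §2 eqs. (22'), (27), (28)] -/
theorem le_sub_trialOperator_opNorm_of_le_sub_duhamel {H J C : Matrix m m ℂ} (hH : H.IsHermitian)
    (hJ : J.IsHermitian) (hC : C.IsHermitian) {β ρ G : ℝ} (hβ : 0 ≤ β)
    (h : ρ ≤ G - β / 2 * (duhamel β H J J).re) :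
    (∀ μ : ℝ, ρ ≤ G - μ * ‖gibbsState β H (C * J - J * C)‖ +
        μ ^ 2 / 2 * ‖C * (H * C - C * H) - (H * C - C * H) * C‖) ∧
      ρ ≤ G - ‖gibbsState β H (C * J - J * C)‖ ^ 2 /
        (2 * ‖C * (H * C - C * H) - (H * C - C * H) * C‖) ∧
      (gibbsState β H (C * (H * C - C * H) - (H * C - C * H) * C)).re ≤
        ‖C * (H * C - C * H) - (H * C - C * H) * C‖ := by
  have hB := bogoliubov_inequality_duhamel hH hJ hC hβ
  have hb := hH.re_duhamel_self_nonneg hJ β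
  have hm : 0 ≤ ‖gibbsState β H (C * J - J * C)‖ := norm_nonneg _
  have hcn : (gibbsState β H (C * (H * C - C * H) - (H * C - C * H) * C)).re ≤
      ‖C * (H * C - C * H) - (H * C - C * H) * C‖ := by
    rcases isEmpty_or_nonempty m with hE | hne
    · have h0 : gibbsState β H (C * (H * C - C * H) - (H * C - C * H) * C) = 0 := by
        rw [gibbsState_apply]; simp [Matrix.trace]
      rw [h0, Complex.zero_re]; exact norm_nonneg _
    · exact (le_abs_self _).trans (abs_re_gibbsState_le hH β _)
  have hB' : ‖gibbsState β H (C * J - J * C)‖ ^ 2 ≤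
      β * (duhamel β H J J).re * ‖C * (H * C - C * H) - (H * C - C * H) * C‖ :=
    hB.trans (mul_le_mul_of_nonneg_left hcn (mul_nonneg hβ hb))
  refine ⟨fun μ => ?_, ?_, hcn⟩
  · have := trial_le_half_mul_of_sq_le hβ hb (norm_nonneg _) hm hB' μ
    linarith
  · have := sq_div_le_half_mul_of_sq_le hβ hb (norm_nonneg _) hB'
    linarith

end OpNorm

section OpNormTorus

open Literature.Probability.LatticeModels

variable {L : ℕ} [NeZero L]

/-- **Operator-norm form for the `t–t'` torus** (`L ≥ 3`, every `t', U`, `β > 0`, `θ₀ > 0`,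
every coordinate sector `p`, every admissible `ρ_s`, every Hermitian `C` on the sector space):
`ρ_s L² ≤ Re⟨K_p⟩/2 − μ‖⟨CJ_p − J_pC⟩‖ + (μ²/2)‖C[H_p,C] − [H_p,C]C‖` for every `μ : ℝ`, and
`ρ_s L² ≤ Re⟨K_p⟩/2 − ‖⟨CJ_p − J_pC⟩‖²/(2‖C[H_p,C] − [H_p,C]C‖)`.
[cite: DLS1978, §2 eqs. (22'), (27), (28)] [cite: ScalapinoWhiteZhang1993, §II] -/
theorem thermalStiffnessTT'_le_kin_sub_trialOperator_opNorm (hL : 3 ≤ L) (t' U : ℝ)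
    {β ρs θ₀ : ℝ} (hβ : 0 < β) (hθ₀ : 0 < θ₀) (p : Finset (Orb (FermionTorus 2 L)) → Prop)
    [Fintype {a // p a}] [DecidableEq {a // p a}]
    (hstiff : ∀ θ : ℝ, |θ| ≤ θ₀ → β * ρs * θ ^ 2 ≤
        Real.log (partitionFn β ((hubbardTorusTT'Flux L t' U 0).toBlock p p)).re -
          Real.log (partitionFn β ((hubbardTorusTT'Flux L t' U θ).toBlock p p)).re)
    {C : Matrix {a // p a} {a // p a} ℂ} (hC : C.IsHermitian) :
    (∀ μ : ℝ, ρs * (L : ℝ) ^ 2 ≤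
        (gibbsState β ((hubbardTorusTT' L 1 t' U).toBlock p p)
            ((kinOpTT' L t').toBlock p p)).re / 2 -
          μ * ‖gibbsState β ((hubbardTorusTT' L 1 t' U).toBlock p p)
            (C * (curOpTT' L t').toBlock p p - (curOpTT' L t').toBlock p p * C)‖ +
          μ ^ 2 / 2 * ‖C * ((hubbardTorusTT' L 1 t' U).toBlock p p * C -
                C * (hubbardTorusTT' L 1 t' U).toBlock p p) -
              ((hubbardTorusTT' L 1 t' U).toBlock p p * C -
                C * (hubbardTorusTT' L 1 t' U).toBlock p p) * C‖) ∧
      ρs * (L : ℝ) ^ 2 ≤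
        (gibbsState β ((hubbardTorusTT' L 1 t' U).toBlock p p)
            ((kinOpTT' L t').toBlock p p)).re / 2 -
          ‖gibbsState β ((hubbardTorusTT' L 1 t' U).toBlock p p)
            (C * (curOpTT' L t').toBlock p p - (curOpTT' L t').toBlock p p * C)‖ ^ 2 /
          (2 * ‖C * ((hubbardTorusTT' L 1 t' U).toBlock p p * C -
                C * (hubbardTorusTT' L 1 t' U).toBlock p p) -
              ((hubbardTorusTT' L 1 t' U).toBlock p p * C -
                C * (hubbardTorusTT' L 1 t' U).toBlock p p) * C‖) := by
  have hHp : ((hubbardTorusTT' L 1 t' U).toBlock p p).IsHermitian :=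
    (hubbardTorusTT'_isHermitian L 1 t' U).submatrix _
  have hJp : ((curOpTT' L t').toBlock p p).IsHermitian :=
    (isHermitian_curOpTT' (L := L) t').submatrix _
  obtain ⟨h1, -⟩ := thermalStiffnessTT'_le_kin_sub_duhamel hL t' U hβ hθ₀ p hstiff
  obtain ⟨h2, h3, -⟩ := le_sub_trialOperator_opNorm_of_le_sub_duhamel hHp hJp hC hβ.le h1
  exact ⟨h2, h3⟩

/-- **Node (THEOREM, proved below): operator-norm form for the `t–t'` torus.** For `L ≥ 3`,
every `t', U`, `0 < β`, `0 < θ₀`, every coordinate sector `p`, every admissible `ρ_s`, every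
Hermitian `C` on the sector space: (i) `ρ_s L² ≤ Re⟨K_p⟩/2 − μ‖⟨CJ_p − J_pC⟩‖ +
(μ²/2)‖C[H_p,C] − [H_p,C]C‖` for every `μ : ℝ`; (ii) `ρ_s L² ≤ Re⟨K_p⟩/2 −
‖⟨CJ_p − J_pC⟩‖²/(2‖C[H_p,C] − [H_p,C]C‖)` — state-free curvature (operator norm).
[cite: DLS1978, §2 eqs. (22'), (27), (28)] [cite: ScalapinoWhiteZhang1993, §II] -/
@[conjecture] def ThermalTrialOperatorOpNormStiffnessCeilingTT' : Prop :=
  ∀ (L : ℕ) [NeZero L], 3 ≤ L → ∀ (t' U β ρs θ₀ : ℝ), 0 < β → 0 < θ₀ →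
    ∀ (p : Finset (Orb (FermionTorus 2 L)) → Prop) [Fintype {a // p a}] [DecidableEq {a // p a}],
    (∀ θ : ℝ, |θ| ≤ θ₀ → β * ρs * θ ^ 2 ≤
        Real.log (partitionFn β ((hubbardTorusTT'Flux L t' U 0).toBlock p p)).re -
          Real.log (partitionFn β ((hubbardTorusTT'Flux L t' U θ).toBlock p p)).re) →
    ∀ (C : Matrix {a // p a} {a // p a} ℂ), C.IsHermitian →
    let Hp := (hubbardTorusTT' L 1 t' U).toBlock p p
    let Kp := (kinOpTT' L t').toBlock p p
    let Jp := (curOpTT' L t').toBlock p p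
    (∀ μ : ℝ, ρs * (L : ℝ) ^ 2 ≤ (gibbsState β Hp Kp).re / 2 -
        μ * ‖gibbsState β Hp (C * Jp - Jp * C)‖ +
        μ ^ 2 / 2 * ‖C * (Hp * C - C * Hp) - (Hp * C - C * Hp) * C‖) ∧
      ρs * (L : ℝ) ^ 2 ≤ (gibbsState β Hp Kp).re / 2 -
        ‖gibbsState β Hp (C * Jp - Jp * C)‖ ^ 2 /
          (2 * ‖C * (Hp * C - C * Hp) - (Hp * C - C * Hp) * C‖)

/-- Proof of the node `ThermalTrialOperatorOpNormStiffnessCeilingTT'`. -/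
theorem thermalTrialOperatorOpNormStiffnessCeilingTT'_holds :
    ThermalTrialOperatorOpNormStiffnessCeilingTT' := by
  intro L _ hL t' U β ρs θ₀ hβ hθ₀ p _ _ hstiff C hC Hp Kp Jp
  exact thermalStiffnessTT'_le_kin_sub_trialOperator_opNorm hL t' U hβ hθ₀ p hstiff hC

end OpNormTorus

section OpNormClass

variable {Λ : Type} [LinearOrder Λ] [Fintype Λ]

/-- **Operator-norm form for the number-conserving class** (setting and flux-floor hypothesis of
`thermalKuboCurvatureCeiling_numberConserving`; every Hermitian `C` on the sector space):
`ρ ≤ G₁^β(d) − μ‖⟨CJ_p − J_pC⟩‖ + (μ²/2)‖C[H_p,C] − [H_p,C]C‖` for every `μ : ℝ`, and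
`ρ ≤ G₁^β(d) − ‖⟨CJ_p − J_pC⟩‖²/(2‖C[H_p,C] − [H_p,C]C‖)`.
[cite: DLS1978, §2 eqs. (22'), (27), (28)] [cite: ParamekantiTrivediRanderia1998, §IV] -/
theorem thermalStiffness_le_fsum_sub_trialOperator_opNorm_numberConserving {t d : Λ → Λ → ℝ}
    (ht : ∀ x y, t y x = t x y) (hd : ∀ x y, d y x = -d x y)
    {V : Matrix (Finset (Orb Λ)) (Finset (Orb Λ)) ℂ} (hV : V.IsHermitian) {β : ℝ} (hβ : 0 < β)
    (p : Finset (Orb Λ) → Prop) [Fintype {a // p a}] [DecidableEq {a // p a}] {ρ θ₀ : ℝ}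
    (hθ₀ : 0 < θ₀)
    (hstiff : ∀ θ : ℝ, |θ| ≤ θ₀ →
      β * (ρ * θ ^ 2) ≤
        Real.log (partitionFn β ((bdgHopping (fun x y => (t x y : ℂ)) + V).toBlock p p)).re -
          Real.log (partitionFn β
            ((bdgHopping (fun x y => (t x y : ℂ) *
                Complex.exp (((θ * d x y : ℝ) : ℂ) * Complex.I)) + V).toBlock p p)).re)
    {C : Matrix {a // p a} {a // p a} ℂ} (hC : C.IsHermitian) :
    (∀ μ : ℝ, ρ ≤ (∑ x : Λ, ∑ y : Λ, ∑ σ : Fin 2, d x y ^ 2 *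
          (-(t x y * (gibbsState β ((bdgHopping (fun x y => (t x y : ℂ)) + V).toBlock p p)
            ((creation (orb x σ) * annihilation (orb y σ)).toBlock p p)).re) / 2)) -
        μ * ‖gibbsState β ((bdgHopping (fun x y => (t x y : ℂ)) + V).toBlock p p)
          (C * (bdgHopping fun x y => ((t x y * d x y : ℝ) : ℂ) * Complex.I).toBlock p p -
            (bdgHopping fun x y => ((t x y * d x y : ℝ) : ℂ) * Complex.I).toBlock p p * C)‖ +
        μ ^ 2 / 2 * ‖C * ((bdgHopping (fun x y => (t x y : ℂ)) + V).toBlock p p * C -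
              C * (bdgHopping (fun x y => (t x y : ℂ)) + V).toBlock p p) -
            ((bdgHopping (fun x y => (t x y : ℂ)) + V).toBlock p p * C -
              C * (bdgHopping (fun x y => (t x y : ℂ)) + V).toBlock p p) * C‖) ∧
      ρ ≤ (∑ x : Λ, ∑ y : Λ, ∑ σ : Fin 2, d x y ^ 2 *
          (-(t x y * (gibbsState β ((bdgHopping (fun x y => (t x y : ℂ)) + V).toBlock p p)
            ((creation (orb x σ) * annihilation (orb y σ)).toBlock p p)).re) / 2)) -
        ‖gibbsState β ((bdgHopping (fun x y => (t x y : ℂ)) + V).toBlock p p)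
          (C * (bdgHopping fun x y => ((t x y * d x y : ℝ) : ℂ) * Complex.I).toBlock p p -
            (bdgHopping fun x y => ((t x y * d x y : ℝ) : ℂ) * Complex.I).toBlock p p * C)‖ ^ 2 /
        (2 * ‖C * ((bdgHopping (fun x y => (t x y : ℂ)) + V).toBlock p p * C -
              C * (bdgHopping (fun x y => (t x y : ℂ)) + V).toBlock p p) -
            ((bdgHopping (fun x y => (t x y : ℂ)) + V).toBlock p p * C -
              C * (bdgHopping (fun x y => (t x y : ℂ)) + V).toBlock p p) * C‖) := by
  have hHp : ((bdgHopping (fun x y => (t x y : ℂ)) + V).toBlock p p).IsHermitian :=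
    ((isHermitian_bdgHopping_real ht).add hV).submatrix _
  have hJp : ((bdgHopping fun x y => ((t x y * d x y : ℝ) : ℂ) * Complex.I).toBlock p p).IsHermitian :=
    (isHermitian_current ht hd).submatrix _
  obtain ⟨h1, -⟩ := thermalKuboCurvatureCeiling_numberConserving ht hd hV hβ p hθ₀ hstiff
  obtain ⟨h2, h3, -⟩ := le_sub_trialOperator_opNorm_of_le_sub_duhamel hHp hJp hC hβ.le h1
  exact ⟨h2, h3⟩

/-- **Node (THEOREM, proved below): operator-norm form for the number-conserving class**
(setting of `ThermalTrialOperatorStiffnessCeilingNumberConserving`): the flux-floor hypothesis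
implies, for every Hermitian `C` on the sector space, (i) `ρ ≤ G₁^β(d) − μ‖⟨CJ_p − J_pC⟩‖ +
(μ²/2)‖C[H_p,C] − [H_p,C]C‖` for every `μ : ℝ` and (ii) `ρ ≤ G₁^β(d) −
‖⟨CJ_p − J_pC⟩‖²/(2‖C[H_p,C] − [H_p,C]C‖)` — the ceiling depends on the Gibbs state only through
`G₁^β(d)` and the one commutator expectation `⟨CJ_p − J_pC⟩`.
[cite: DLS1978, §2 eqs. (22'), (27), (28)] [cite: ParamekantiTrivediRanderia1998, §IV] -/
@[conjecture] def ThermalTrialOperatorOpNormStiffnessCeilingNumberConserving : Prop :=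
  ∀ (Λ : Type) [LinearOrder Λ] [Fintype Λ] (t d : Λ → Λ → ℝ), (∀ x y, t y x = t x y) →
    (∀ x y, d y x = -d x y) → ∀ (V : Matrix (Finset (Orb Λ)) (Finset (Orb Λ)) ℂ), V.IsHermitian →
    ∀ (β : ℝ), 0 < β → ∀ (p : Finset (Orb Λ) → Prop) [Fintype {a // p a}] [DecidableEq {a // p a}]
      (ρ θ₀ : ℝ), 0 < θ₀ →
      (∀ θ : ℝ, |θ| ≤ θ₀ →
        β * (ρ * θ ^ 2) ≤
          Real.log (partitionFn β ((bdgHopping (fun x y => (t x y : ℂ)) + V).toBlock p p)).re -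
            Real.log (partitionFn β
              ((bdgHopping (fun x y => (t x y : ℂ) *
                  Complex.exp (((θ * d x y : ℝ) : ℂ) * Complex.I)) + V).toBlock p p)).re) →
      ∀ (C : Matrix {a // p a} {a // p a} ℂ), C.IsHermitian →
      let Hp := (bdgHopping (fun x y => (t x y : ℂ)) + V).toBlock p p
      let Jp := (bdgHopping fun x y => ((t x y * d x y : ℝ) : ℂ) * Complex.I).toBlock p p
      let G := ∑ x : Λ, ∑ y : Λ, ∑ σ : Fin 2, d x y ^ 2 *
            (-(t x y * (gibbsState β Hp
              ((creation (orb x σ) * annihilation (orb y σ)).toBlock p p)).re) / 2)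
      (∀ μ : ℝ, ρ ≤ G - μ * ‖gibbsState β Hp (C * Jp - Jp * C)‖ +
          μ ^ 2 / 2 * ‖C * (Hp * C - C * Hp) - (Hp * C - C * Hp) * C‖) ∧
        ρ ≤ G - ‖gibbsState β Hp (C * Jp - Jp * C)‖ ^ 2 /
          (2 * ‖C * (Hp * C - C * Hp) - (Hp * C - C * Hp) * C‖)

/-- Proof of the node `ThermalTrialOperatorOpNormStiffnessCeilingNumberConserving`. -/
theorem thermalTrialOperatorOpNormStiffnessCeilingNumberConserving_holds :
    ThermalTrialOperatorOpNormStiffnessCeilingNumberConserving := by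
  intro Λ _ _ t d ht hd V hV β hβ p _ _ ρ θ₀ hθ₀ hstiff C hC Hp Jp G
  exact thermalStiffness_le_fsum_sub_trialOperator_opNorm_numberConserving ht hd hV hβ p hθ₀
    hstiff hC

end OpNormClass

end Summit.HubbardSuperconductivity.HubbardLadder.Bounds
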